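import Summits.BirchSwinnertonDyer.BirchSwinnertonDyer.Theses.ErratumRoadFive
import Summits.BirchSwinnertonDyer.BirchSwinnertonDyer.Theorems.ErratumRoadFiveNonSurjCornerTwinMuAnCertificateShape
import Summits.BirchSwinnertonDyer.BirchSwinnertonDyer.Theorems.ErratumRoadFiveNonSurjCornerTwinLeaf
import Summits.BirchSwinnertonDyer.Rank1Residual.X11b.BDPRouteNoRam
import Summits.BirchSwinnertonDyer.Rank1Residual.X11b.TwistTransportTam
import Literature.NumberTheory.EllipticCurves.QuadraticTwistPadicReduction
import Literature.NumberTheory.EllipticCurves.BSDSelmerSkinnerThmBProofs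
import Literature.NumberTheory.EllipticCurves.LFunctionSmulProofs
import HarnessLib

/-!
# Route `ErratumRoadFive`, crux 19065 `NonSurjCorner`, child 19948 `NonSurjCornerTwinMuAn`: the per-twin certificate
# shape KEYED BY THE CORNER PAIR AND THE HEEGNER FRAME — on a non-split corner pair with `p ∤ ∏c(E)` the certificate
# of EVERY Heegner twin is «`p ∤ #Ш_an(E^{d_K})`» (cell `bsd-stepL`, seat `bsd-stepL-corner5-p2` g7; `--supports 19948 --as helper`)

The shape theorems of this seat (p587429 ∕ p587950 ∕ p588611; route-keyed in p588996) are phrased on the TWIN `Wd` (the currency of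
19948's stubs). The crux 19065 and its Kolyvagin children 19946 ∕ 19947 are phrased on the corner PAIR `(E, p)` and a
classical Heegner FRAME `K`. This file transports the twin-side conditions back to the pair along the frame, using the b2b
cell's twist-transport theorems (all tree THEOREMS): `X11b.classX11a_twist_of_not_ram` (the twin is an X11a pair),
`X11b.not_surj_twist_model` (`ρ̄` stays non-surjective), `X11b.isSquare_discr_padic_of_heegner` + Mathlib-level
`hasSplitMultiplicativeReductionAtPrime_quadraticTwist_iff` ∕ `…_smul_iff` (split at `p` ⟺ split at `p`: `d_K` is a square
in `ℚ_p`), `X11b.padicValNat_tamagawaProduct_twist_of_heegner` (`ord_p ∏c(Wd) = ord_p ∏c(E)`, JSW §7.4.1 (eq:tamK) as a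
theorem), and lane B g4's `CornerLocal.NonSurjTwin.dvd_tamagawaProduct_iff_exists_split`.

* §1 `HeegnerTwin.hasSplitMultiplicativeReductionAtPrime_iff`, `HeegnerTwin.not_dvd_tamagawaProduct_iff` — frame transport;
* §2 **`NonSurjCorner.twin_find_nonsplit_shape`**: corner pair `(E,p)` NON-split at `p`, frame `K`, twin `Wd = Cd • E^{(d_K)}`
  globally minimal with `L(E^{d_K},1) ≠ 0`, `shaAn Wd = q` (`q ≠ 0`, `ord_p q ≥ 0`), facts `KatoTwinFactsFiveAn` (19949): the
  least witness `n₀` of `stub_twinMuAn_nonsplit` at `Wd` is **`0 ⟺ (ord_p q = 0 ∧ p ∤ ∏c(E))`, else even `≥ 2`**; hence on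
  the `t = 0` sub-corner (`p ∤ ∏c(E)`; 24 of the 29 non-split census pairs at `5`) **`n₀ = 0 ⟺ ord_p #Ш_an(E^{d_K}) = 0`**
  (`…_of_not_dvd_tamagawaProduct`) — the census's unit-VALUE column, read as a theorem about the pair;
* §3 **`NonSurjCorner.twin_three_le_find_of_split`**: corner pair SPLIT at `p` ⟹ at every frame the twin's least witness
  is odd and `≥ 3`.

HONEST FRAMING: theorems only (no definition, no named fact, no `sorry`); conditional on the OPEN support item
`KatoTwinFactsFiveAn` (23 published facts) taken as a hypothesis and on the per-twin numeric datum `shaAn Wd = q`; the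
class-wide content of 19948 (Greenberg Conj. 1.11) is untouched; nothing closes (T7); BSD is proved for no class.
References: [JetchevSkinnerWan2017] §7.4.1 (eq:tamK); [SilvermanAEC2009] X.5 Cor. 5.4, VII.5 Prop. 5.1(b); [Serre1973]
II.3.3; [MazurTateTeitelbaum1986Invent] §I.10, §I.15, §I.17–18; tree: b2b `X11b/TwistTransport*.lean`, `X11b/BDPRouteNoRam.lean`.
-/

set_option autoImplicit false
set_option linter.dupNamespace false

noncomputable section

open scoped Classical NumberField MatrixGroups ModularForm

namespace Summit.BirchSwinnertonDyer.BirchSwinnertonDyer.Theorems.TatePow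

open CongruenceSubgroup PowerSeries WeierstrassCurve IsDedekindDomain Rat.HeightOneSpectrum
  Literature.NumberTheory.EllipticCurves Literature.NumberTheory.EllipticCurves.ModularForms
  Literature.NumberTheory.EllipticCurves.Rank1Residual Summit.BirchSwinnertonDyer.Rank1Residual
  Summit.BirchSwinnertonDyer.Rank1Residual.X11b Summit.BirchSwinnertonDyer.BirchSwinnertonDyer.Theses.ErratumRoadFive

variable {W : WeierstrassCurve ℚ} [W.IsElliptic] [W.IsGloballyMinimal] {p : ℕ} [Fact p.Prime]

/-! ### §1 Frame transport: split at `p`, and `p ∣ ∏c` -/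

omit [W.IsGloballyMinimal] in
/-- **At a prime `p` of multiplicative reduction of `E`, a Heegner twist is split at `p` iff `E` is**: every prime of
`N_E` splits in `K`, so `d_K` is a square in `ℚ_p` (`isSquare_discr_padic_of_heegner`) and `E^{(d_K)} ≅ E` over `ℚ_p`
(`hasSplitMultiplicativeReductionAtPrime_quadraticTwist_iff`); a rational change of variables does not change the reduction
type (`hasSplitMultiplicativeReductionAtPrime_smul_iff`). [cite: SilvermanAEC2009, X.5 Cor. 5.4 and VII.5 Prop. 5.1(b)]
[cite: Serre1973, Ch. II §3.3 Thms 3–4] -/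
theorem HeegnerTwin.hasSplitMultiplicativeReductionAtPrime_iff (K : Type) [Field K] [NumberField K]
    (hK : IsImaginaryQuadratic K) (hHN : SatisfiesHeegnerHypothesis (W.conductorNorm ℤ) K)
    (hmult : W.HasMultiplicativeReductionAtPrime p) {Wd : WeierstrassCurve ℚ} [Wd.IsElliptic]
    (Cd : VariableChange ℚ) (hWd : Cd • W.quadraticTwist (NumberField.discr K : ℚ) = Wd) :
    Wd.HasSplitMultiplicativeReductionAtPrime p ↔ W.HasSplitMultiplicativeReductionAtPrime p := by
  have hD0 : (NumberField.discr K : ℚ) ≠ 0 := by exact_mod_cast NumberField.discr_ne_zero K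
  have hpN : p ∣ W.conductorNorm ℤ := (W.dvd_conductorNorm_iff_not_hasGoodReductionAtPrime p).mpr
    (WeierstrassCurve.HasMultiplicativeReduction.not_hasGoodReduction (R := ℤ_[p]) hmult)
  have hsq := isSquare_discr_padic_of_heegner K hK hHN p hpN
  haveI : (W.quadraticTwist (NumberField.discr K : ℚ)).IsElliptic := W.isElliptic_quadraticTwist hD0
  rw [← hWd, hasSplitMultiplicativeReductionAtPrime_smul_iff,
    W.hasSplitMultiplicativeReductionAtPrime_quadraticTwist_iff hD0 hsq]

omit [W.IsGloballyMinimal] in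
/-- **`p ∣ ∏c(E^{(d_K)}) ⟺ p ∣ ∏c(E)` for a Heegner twist, `p ≥ 5`** (`ord_p ∏c(Wd) = ord_p ∏c(E)`: JSW 2017 §7.4.1
(eq:tamK) as the tree theorem `X11b.padicValNat_tamagawaProduct_twist_of_heegner`). [cite: JetchevSkinnerWan2017, §7.4.1 (eq:tamK)] -/
theorem HeegnerTwin.dvd_tamagawaProduct_iff (hp5 : 5 ≤ p) (K : Type) [Field K] [NumberField K]
    (hK : IsImaginaryQuadratic K) (hHN : SatisfiesHeegnerHypothesis (W.conductorNorm ℤ) K)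
    {Wd : WeierstrassCurve ℚ} [Wd.IsElliptic] (Cd : VariableChange ℚ)
    (hWd : Cd • W.quadraticTwist (NumberField.discr K : ℚ) = Wd) :
    p ∣ Wd.tamagawaProduct ↔ p ∣ W.tamagawaProduct := by
  have h := padicValNat_tamagawaProduct_twist_of_heegner W p hp5 K hK hHN Cd hWd
  rw [dvd_iff_padicValNat_ne_zero (Wd.tamagawaProduct_pos').ne', dvd_iff_padicValNat_ne_zero (W.tamagawaProduct_pos').ne', h]

/-! ### §2 The non-split corner pair: the certificate of every Heegner twin, keyed by the pair -/

/-- **Non-split corner pair, Heegner frame: the twin's certificate shape in the PAIR's invariants.** Let `(E,p)` be a corner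
pair (`ClassX11b`, `ρ̄` not onto, `p ∈ {5,7}`, no (ram) witness) with `p` NON-split, `K` a Heegner frame (imaginary quadratic,
every prime of `N_E` split), `Wd = Cd • E^{(d_K)}` a globally minimal twin with `L(E^{(d_K)},1) ≠ 0`, `f ∕ ϖ ∕ L` as in
`stub_twinMuAn_nonsplit` at `Wd`, `shaAn Wd = q ≠ 0` with `ord_p q ≥ 0`, and grant the route's fact bundle `KatoTwinFactsFiveAn`
(19949). Then the least witness `n₀` of the stub's `∃ n` satisfies: **`n₀ = 0 ⟺ (ord_p q = 0 ∧ p ∤ ∏c(E))`, and otherwise `n₀` is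
even and `≥ 2`.** [cite: MazurTateTeitelbaum1986Invent, §I.10, §I.17 and §I.18] [cite: JetchevSkinnerWan2017, §7.4.1 (eq:tamK)] -/
theorem NonSurjCorner.twin_find_nonsplit_shape (hF : KatoTwinFactsFiveAn) (hX : ClassX11b W p) (hns : ¬ Surj W p)
    (h57 : p = 5 ∨ p = 7) (hnram : ¬ Ram W p) (hnsp : ¬ W.HasSplitMultiplicativeReductionAtPrime p)
    (K : Type) [Field K] [NumberField K] (hK : IsImaginaryQuadratic K)
    (hHN : SatisfiesHeegnerHypothesis (W.conductorNorm ℤ) K)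
    {Wd : WeierstrassCurve ℚ} [Wd.IsElliptic] [Wd.IsGloballyMinimal] (Cd : VariableChange ℚ)
    (hWd : Cd • W.quadraticTwist (NumberField.discr K : ℚ) = Wd)
    (hLt : (W.quadraticTwist (NumberField.discr K : ℚ)).entireLFunction 1 ≠ 0)
    {N : ℕ} [NeZero N] {f : CuspForm (Gamma0 N) 2} (hf : IsNewformOf Wd f) {ϖ : ℚ}
    (hϖ : (ϖ : ℝ) * Wd.realPeriodRat = plusPeriod f) {L : PowerSeries ℚ_[p]} (hL : IsMultPAdicLFunctionOf f p (-1) L)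
    {q : ℚ} (hq : shaAn Wd = (q : ℂ)) (hq0 : q ≠ 0) (hint : 0 ≤ padicValRat p q)
    (h : ∃ n : ℕ, ‖PowerSeries.coeff n (PowerSeries.C ((ϖ : ℚ) : ℚ_[p]) * L)‖ = 1) :
    (Nat.find h = 0 ↔ (padicValRat p q = 0 ∧ ¬ p ∣ W.tamagawaProduct)) ∧
      (Nat.find h ≠ 0 → 2 ≤ Nat.find h ∧ Even (Nat.find h)) := by
  have hp5 : 5 ≤ p := by rcases h57 with rfl | rfl <;> norm_num
  have hD0 : (NumberField.discr K : ℚ) ≠ 0 := by exact_mod_cast NumberField.discr_ne_zero K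
  haveI : (W.quadraticTwist (NumberField.discr K : ℚ)).IsElliptic := W.isElliptic_quadraticTwist hD0
  have hrd : Wd.analyticRank = 0 := by
    rw [← hWd, analyticRank_smul]
    exact analyticRank_eq_zero_of_entireLFunction_one_ne_zero _ hLt
  have hXa : ClassX11a Wd p := classX11a_twist_of_not_ram W p hX hnram K hK hHN Cd hWd hrd
  have hnsd : ¬ Surj Wd p := not_surj_twist_model W p hD0 hns Cd hWd
  have hnsTwin : ¬ Wd.HasSplitMultiplicativeReductionAtPrime p := by
    rw [HeegnerTwin.hasSplitMultiplicativeReductionAtPrime_iff K hK hHN hX.2.2.1 Cd hWd]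
    exact hnsp
  obtain ⟨-, -, -, hGZK, -, hmod, -, -, -, -, -, -, -, -, -, -, -, -, -, -, -, hWu, -⟩ := hF
  obtain ⟨h0, hne⟩ := NonSurjTwin.find_nonsplit_shape hWu hmod hGZK hXa hnsd h57 hnsTwin hf hϖ hL hq hq0 hint h
  refine ⟨?_, hne⟩
  have hTw : (∀ v : HeightOneSpectrum (𝓞 ℚ), ¬ Wd.HasSplitMultiplicativeReductionAt v) ↔ ¬ p ∣ W.tamagawaProduct := by
    rw [← HeegnerTwin.dvd_tamagawaProduct_iff hp5 K hK hHN Cd hWd,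
      Summit.BirchSwinnertonDyer.BirchSwinnertonDyer.Theorems.CornerLocal.NonSurjTwin.dvd_tamagawaProduct_iff_exists_split
        Wd p hXa hnsd hp5, not_exists]
  rw [h0, hTw]

/-- **The `t = 0` sub-corner: the certificate of EVERY Heegner twin is «`p ∤ #Ш_an(E^{(d_K)})`».** Same frame as
`NonSurjCorner.twin_find_nonsplit_shape` with `p ∤ ∏c(E)` (no split multiplicative place of `E`; on the corner this forces `p`
non-split, lane B g4): the least witness of `stub_twinMuAn_nonsplit` at the twin is `0` iff `ord_p q = 0` (`shaAn Wd = q`), and is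
even `≥ 2` otherwise. [cite: MazurTateTeitelbaum1986Invent, §I.10, §I.17 and §I.18] [cite: SilvermanATAEC1994, Cor. IV.9.2 (d)] -/
theorem NonSurjCorner.twin_find_eq_zero_iff_of_not_dvd_tamagawaProduct (hF : KatoTwinFactsFiveAn) (hX : ClassX11b W p)
    (hns : ¬ Surj W p) (h57 : p = 5 ∨ p = 7) (hnram : ¬ Ram W p) (ht0 : ¬ p ∣ W.tamagawaProduct)
    (K : Type) [Field K] [NumberField K] (hK : IsImaginaryQuadratic K)
    (hHN : SatisfiesHeegnerHypothesis (W.conductorNorm ℤ) K)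
    {Wd : WeierstrassCurve ℚ} [Wd.IsElliptic] [Wd.IsGloballyMinimal] (Cd : VariableChange ℚ)
    (hWd : Cd • W.quadraticTwist (NumberField.discr K : ℚ) = Wd)
    (hLt : (W.quadraticTwist (NumberField.discr K : ℚ)).entireLFunction 1 ≠ 0)
    {N : ℕ} [NeZero N] {f : CuspForm (Gamma0 N) 2} (hf : IsNewformOf Wd f) {ϖ : ℚ}
    (hϖ : (ϖ : ℝ) * Wd.realPeriodRat = plusPeriod f) {L : PowerSeries ℚ_[p]} (hL : IsMultPAdicLFunctionOf f p (-1) L)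
    {q : ℚ} (hq : shaAn Wd = (q : ℂ)) (hq0 : q ≠ 0) (hint : 0 ≤ padicValRat p q)
    (h : ∃ n : ℕ, ‖PowerSeries.coeff n (PowerSeries.C ((ϖ : ℚ) : ℚ_[p]) * L)‖ = 1) :
    (Nat.find h = 0 ↔ padicValRat p q = 0) ∧ (Nat.find h ≠ 0 → 2 ≤ Nat.find h ∧ Even (Nat.find h)) := by
  have hnsp : ¬ W.HasSplitMultiplicativeReductionAtPrime p :=
    Summit.BirchSwinnertonDyer.BirchSwinnertonDyer.Theorems.CornerLocal.NonSurjCorner.not_hasSplitMultiplicativeReductionAtPrime_of_not_dvd_tamagawaProduct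
      W p hX hns ht0 p
  obtain ⟨h0, hne⟩ := NonSurjCorner.twin_find_nonsplit_shape hF hX hns h57 hnram hnsp K hK hHN Cd hWd hLt hf hϖ hL hq hq0 hint h
  exact ⟨h0.trans ⟨fun h' ↦ h'.1, fun h' ↦ ⟨h', ht0⟩⟩, hne⟩

/-! ### §3 The split corner pair: every Heegner twin's certificate is odd and `≥ 3` -/

/-- **Split corner pair, Heegner frame: the twin's certificate index is odd and `≥ 3`.** `(E,p)` a corner pair with `p` SPLIT,
`K`, `Wd`, `f ∕ ϖ ∕ L` (the `α = 1` function) as in `stub_twinMuAn_split` at `Wd`, `shaAn Wd = q` (`q ≠ 0`, `ord_p q ≥ 0`),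
facts `KatoTwinFactsFiveAn`: the least witness of the stub's `∃ n` is odd and `≥ 3`.
[cite: MazurTateTeitelbaum1986Invent, §I.15, §I.17 and §I.18] [cite: SilvermanAEC2009, X.5 Cor. 5.4] -/
theorem NonSurjCorner.twin_three_le_find_of_split (hF : KatoTwinFactsFiveAn) (hX : ClassX11b W p) (hns : ¬ Surj W p)
    (h57 : p = 5 ∨ p = 7) (hnram : ¬ Ram W p) (hsp : W.HasSplitMultiplicativeReductionAtPrime p)
    (K : Type) [Field K] [NumberField K] (hK : IsImaginaryQuadratic K)
    (hHN : SatisfiesHeegnerHypothesis (W.conductorNorm ℤ) K)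
    {Wd : WeierstrassCurve ℚ} [Wd.IsElliptic] [Wd.IsGloballyMinimal] (Cd : VariableChange ℚ)
    (hWd : Cd • W.quadraticTwist (NumberField.discr K : ℚ) = Wd)
    (hLt : (W.quadraticTwist (NumberField.discr K : ℚ)).entireLFunction 1 ≠ 0)
    {N : ℕ} [NeZero N] {f : CuspForm (Gamma0 N) 2} (hf : IsNewformOf Wd f) {ϖ : ℚ}
    (hϖ : (ϖ : ℝ) * Wd.realPeriodRat = plusPeriod f) {L : PowerSeries ℚ_[p]} (hL : IsMultPAdicLFunctionOf f p 1 L)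
    {q : ℚ} (hq : shaAn Wd = (q : ℂ)) (hq0 : q ≠ 0) (hint : 0 ≤ padicValRat p q)
    (h : ∃ n : ℕ, ‖PowerSeries.coeff n (PowerSeries.C ((ϖ : ℚ) : ℚ_[p]) * L)‖ = 1) :
    3 ≤ Nat.find h ∧ Odd (Nat.find h) := by
  have hD0 : (NumberField.discr K : ℚ) ≠ 0 := by exact_mod_cast NumberField.discr_ne_zero K
  haveI : (W.quadraticTwist (NumberField.discr K : ℚ)).IsElliptic := W.isElliptic_quadraticTwist hD0
  have hrd : Wd.analyticRank = 0 := by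
    rw [← hWd, analyticRank_smul]
    exact analyticRank_eq_zero_of_entireLFunction_one_ne_zero _ hLt
  have hXa : ClassX11a Wd p := classX11a_twist_of_not_ram W p hX hnram K hK hHN Cd hWd hrd
  have hnsd : ¬ Surj Wd p := not_surj_twist_model W p hD0 hns Cd hWd
  have hspd : Wd.HasSplitMultiplicativeReductionAtPrime p :=
    (HeegnerTwin.hasSplitMultiplicativeReductionAtPrime_iff K hK hHN hX.2.2.1 Cd hWd).mpr hsp
  obtain ⟨-, -, -, hGZK, -, hmod, -, -, -, -, -, -, -, hGS, -, -, -, -, -, -, -, hWu, -⟩ := hF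
  exact NonSurjTwin.three_le_find_of_split_noDatum hWu hmod hGZK (hGS Wd p) hXa hnsd h57 hspd hf hϖ hL hq hq0 hint h

end Summit.BirchSwinnertonDyer.BirchSwinnertonDyer.Theorems.TatePow

end
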